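import Literature.AnabelianGeometry.EtaleTheta.ThetaSubquotientOfTemperedTwistTransport

/-!
# [EtTh] §5 / Thm. 5.6: the Δ-transport of `(l·Δ_Θ)_(−)` along `Ψ^bs ≅ B^temp(φ)` READ THROUGH AN IDENTIFICATION `c ≅ Ψ^bs(a)` —
# the carrier-level shape of `aΨ_A : (l·Δ_Θ)_{A^bs} ⥲ (l·Δ_Θ)_{(Ψ A)^bs}` with `(Ψ A)^bs ≅ Ψ^bs(A^bs)` (`eΨ`) (T56-L03 step 2)

Mochizuki, *The étale theta function and its Frobenioid-theoretic manifestations*, Publ. RIMS **45** (2009), Thm. 5.6 proof p.329 (PDF p.103) l.1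
(«it follows from Propositions 2.4, 2.6 that `Ψ` preserves "`(l·Δ_Θ)_{(−)}`"»), §5 p.327 (PDF p.101) [cite: MochizukiEtTh2009, Thm 5.6 proof p.329 (PDF p.103)].

abc-iut cell, layer L2, seat abc-iut-w5-d013 (gen 4), ROW «T56-L03 step 2».  CLASS (b) CONSTRUCTION over this seat's `ThetaSubquotientOfTemperedTwistTransport`
(p440102): ONE new definition `ThetaSubquotient.psiTransport` (a `MulEquiv`), no structure field, no instance, no notation, no new named Prop fact.
For a functor `F` («`Ψ^bs`») with `η : F ⋙ ι ≅ ι ⋙ B^temp(φ)` ([SemiAnbd] Prop. 3.2; tree: `BTemp.exists_res_iso_of_connectedPart_equivalence`) and an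
identification `e : c ≅ F(a)` (the component `eΨ_A : (Ψ A)^bs ≅ Ψ^bs(A^bs)` of `eΨ : Ψ ⋙ Base ≅ Base ⋙ Ψ^bs`):
* `ThetaSubquotient.psiTransport q ι φ φQ φΛ hq hι F η a c e : LDelta q ι a.obj ≃* LDelta q ι c.obj` — `transportTwist` along `η_a`, then `map e⁻¹`;
* `ThetaSubquotient.map_psiTransport` — NATURALITY along `fb : a → a′`, `gb : c → c′` with `e⁻¹ ≫ gb = F(fb) ≫ e′⁻¹` (the naturality square of
  `eΨ`): `map gb ∘ Δ_a = Δ_{a′} ∘ map fb` — abc-iut-L2-d4's binder `haΨn` at the carrier level;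
* `ThetaSubquotient.psiTransport_autProj` — `Δ_a (autProj_a σ) = autProj_c ((η_a ≫ … ≫ e)⁻¹-conjugate of B^temp(φ)(σ))` — T56-L09c at the carrier level.
WHAT REMAINS for [EtTh] Thm. 5.6's `aΨ`/`haΨn`/T56-L09c at abc-iut-L2-t4's `ofConnectedTemperoidData … (RigidData.levelStub ιX) …` is ONLY the definitional
identification `𝔉.lDeltaModN A = (LDelta q_N ι_N A^bs) ⊗ ℤ/Nℤ` (true by `rfl`; at default heartbeats its unfolding through the four-deep §5 stack is at
the edge of the budget — HOME/staging/w5/w5-d013/g4/T56-L03-STEP2-MEMO.md).  HONEST FRAMING: definitions + kernel-checked lemmas about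
abc-iut-L2-t9's carrier; nothing about the curves of [EtTh] is asserted; no side taken on [IUTchIII] Cor. 3.12.
-/

noncomputable section

namespace Literature.AnabelianGeometry.EtaleTheta

/-! ## (B1) carrier level: transport along `Ψ^bs ≅ B^temp(φ)` read at a second object through an identification -/

namespace ThetaSubquotient

open CategoryTheory Literature.AlgebraicGeometry.Frobenioids Literature.AnabelianGeometry.SemiGraphs

universe u v w

variable {G : Type u} [Group G] [TopologicalSpace G] {Q : Type v} [Group Q] {Λ : Type w}
  [CommGroup Λ] (q : G →* Q) (ι : Λ →* Q) [ι.range.Normal]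
  (φ : G ≃ₜ* G) (φQ : Q ≃* Q) (φΛ : Λ ≃* Λ) (hq : ∀ g : G, q (φ g) = φQ (q g)) (hι : ∀ a : Λ, ι (φΛ a) = φQ (ι a))
  (F : ConnectedPart (BTemp G) ⥤ ConnectedPart (BTemp G))
  (η : F ⋙ (connectedObjects (BTemp G)).ι ≅ (connectedObjects (BTemp G)).ι ⋙ BTemp.res (φ : G →ₜ* G))

/-- **The Δ-transport along `Ψ^bs ≅ B^temp(φ)` read at `c ≅ Ψ^bs(a)`**: `(l·Δ_Θ)_a ⥲ (l·Δ_Θ)_{Ψ^bs a} ⥲ (l·Δ_Θ)_c`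
(`transportTwist` along the component `η_a`, then t9's transport along `e⁻¹`). [cite: MochizukiEtTh2009, Thm 5.6 proof p.329 (PDF p.103)] -/
def psiTransport (a c : ConnectedPart (BTemp G)) (e : c ≅ F.obj a) : LDelta q ι a.obj ≃* LDelta q ι c.obj :=
  (transportTwist q ι φ φQ φΛ hq hι a (F.obj a) (η.app a)).trans
    (mapEquiv q ι (E := (F.obj a).obj) (E' := c.obj) (F.obj a).property c.property ((connectedObjects (BTemp G)).ι.mapIso e.symm))

/-- `psiTransport` unfolded. [cite: MochizukiEtTh2009, Thm 5.6 proof p.329 (PDF p.103)] -/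
theorem psiTransport_apply (a c : ConnectedPart (BTemp G)) (e : c ≅ F.obj a) (y : LDelta q ι a.obj) :
    psiTransport q ι φ φQ φΛ hq hι F η a c e y =
      map q ι (F.obj a).property c.property e.inv.hom (transportTwist q ι φ φQ φΛ hq hι a (F.obj a) (η.app a) y) := rfl

/-- **NATURALITY** of `psiTransport` along `fb : a → a′`, `gb : c → c′` with `e.inv ≫ gb = F.map fb ≫ e′.inv` (the naturality square of the
identification, e.g. of `eΨ : Ψ ⋙ Base ≅ Base ⋙ Ψ^bs`): `map gb ∘ Δ_a = Δ_{a′} ∘ map fb`. [cite: MochizukiEtTh2009, Thm 5.6 proof p.329 (PDF p.103)] -/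
theorem map_psiTransport {a a' c c' : ConnectedPart (BTemp G)} (e : c ≅ F.obj a) (e' : c' ≅ F.obj a') (fb : a ⟶ a') (gb : c ⟶ c')
    (hsq : e.inv ≫ gb = F.map fb ≫ e'.inv) (y : LDelta q ι a.obj) :
    map q ι c.property c'.property gb.hom (psiTransport q ι φ φQ φΛ hq hι F η a c e y) =
      psiTransport q ι φ φQ φΛ hq hι F η a' c' e' (map q ι a.property a'.property fb.hom y) := by
  have hη : (F.map fb).hom ≫ (η.app a').hom = (η.app a).hom ≫ (BTemp.res (φ : G →ₜ* G)).map fb.hom := η.hom.naturality fb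
  have hsq' : e.inv.hom ≫ gb.hom = (F.map fb).hom ≫ e'.inv.hom := by
    rw [← ObjectProperty.FullSubcategory.comp_hom, ← ObjectProperty.FullSubcategory.comp_hom, hsq]
  rw [psiTransport_apply, psiTransport_apply,
    ← map_transportTwist q ι φ φQ φΛ hq hι (η.app a) (η.app a') fb.hom (F.map fb).hom hη,
    ← MonoidHom.comp_apply, ← map_comp q ι (F.obj a).property c.property c'.property,
    ← MonoidHom.comp_apply (map q ι (F.obj a').property c'.property _), ← map_comp q ι (F.obj a).property (F.obj a').property c'.property,
    hsq']

/-- **Agreement with `Aut`'s subquotient**: `Δ (autProj_a σ) = autProj_c (e⁻¹ · η_a⁻¹ · B^temp(φ)(σ) · η_a · e)`.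
[cite: MochizukiEtTh2009, Thm 5.6 proof p.329 (PDF p.103)] -/
theorem psiTransport_autProj (a c : ConnectedPart (BTemp G)) (e : c ≅ F.obj a) (σ : autPre q ι a.obj) :
    psiTransport q ι φ φQ φΛ hq hι F η a c e (autProj q ι a.obj σ) =
      autProj q ι c.obj ⟨((connectedObjects (BTemp G)).ι.mapIso e.symm).conjAut
          ((η.app a).symm.conjAut ((BTemp.res (φ : G →ₜ* G)).mapIso (σ : Aut a.obj))),
        conjAut_mem_autPre q ι _ (conjAut_mem_autPre q ι _ (mapIso_res_mem_autPre q ι φ φQ φΛ hq hι a.obj σ.2))⟩ := by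
  rw [psiTransport_apply, transportTwist_autProj]
  exact map_autProj_iso q ι (F.obj a).property c.property ((connectedObjects (BTemp G)).ι.mapIso e.symm) ⟨_, _⟩

end ThetaSubquotient

end Literature.AnabelianGeometry.EtaleTheta

end
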